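import Summits.BirchSwinnertonDyer.Rank1Residual.X1.KellerYinTheoremAClass
import Summits.BirchSwinnertonDyer.BirchSwinnertonDyer.Theses.SlopeDichotomyA2
import Literature.NumberTheory.EllipticCurves.Rank1Residual.GVParityTwistTransportProofs
import Literature.NumberTheory.EllipticCurves.Rank1Residual.ClassX1KellerYinCertificate
import HarnessLib

/-!
# Crux `DegenerateLocusA2` (route `SlopeDichotomyA2`, item stmt-BirchSwinnertonDyer-19086) — indeed the
# whole rung-I1 leaf `TypeBRankOneUnridered` — by the SCHNEIDER-FREE anticyclotomic road of Keller–Yin: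
# the type-B twin of the `bsd-eis` cell's THEOREM A, from ONE preprint statement (KY Thm. 3.0.8 at `𝟙`
# for the good lattice), the `EisensteinPrimes` crux `MazurMCOnX1RankZero`, and PUBLISHED facts

Support file (prover seat `bsd-schneider-i1-c2`, gen 2, cell `bsd-schneider-ideate`; `--supports
stmt-BirchSwinnertonDyer-19086`). THEOREMS ONLY; nothing is unconditional and nothing is booked: every
open input enters BY NAME as a hypothesis (the three theorems concluding a registered statement are
conditional results and credit nothing).

THE POINT. Route `SlopeDichotomyA2` (rung I1-weaken) was born on the reading (route file, Novelty)
that the anticyclotomic road to the `p`-part of BSD in analytic rank `≤ 1` at an Eisenstein prime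
"requires `φ|_{G_p} ≠ 1, ω`, i.e. `p` NON-anomalous" (Castella–Grossi–Lee–Skinner 2022,
Castella–Grossi–Skinner), so that on corner A2 (`X1.TypeBRankOne`: `p > 2` good ANOMALOUS, `E[p]`
reducible, Greenberg–Vatsal parity type B, `ord_{s=1} L(E,s) = 1`) only the cyclotomic road
(Schneider rider) or a critical-slope β-road could act, and the crux `DegenerateLocusA2` (= `BSD(E,p)`
on the A2 pairs whose canonical cyclotomic `p`-adic height degenerates) was filed as a FRONTIER
conjecture. Keller–Yin, arXiv:2402.12781v2, treat exactly the excluded case ("The cases left out in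
[CGLS] are when one of `φ|_{G_p}, ψ|_{G_p}` is trivial. Hence we assume this is the case", §2, first
paragraph; "the assumption that `φ|_{G_p} ≠ 1, ω` is removed by us", proof of Thm. 4.2.1), and the
tree carries their road for parity TYPE A (`X1.KellerYinTheoremA`, files 1–3 of seat `bsd-eis-ky`):
`BSD(E,p)` on X1 ∩ {type A, `r_an = 1`} from the ONE preprint statement
`KellerYin2024.thm308_imc2_bdpValue_goodLattice_OPEN` (`h308`, stated WITHOUT any parity hypothesis)
and published facts, the rank-zero partner `E^K` being of type B (Greenberg–Vatsal). This file is the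
TYPE-B twin: the Keller–Yin display for the good lattice (`KellerYinTheoremA.display_at_goodLattice`)
uses no parity; the only parity-dependent step is the partner — the admissible odd twist `E^K` of a
type-B curve is a class-X1 pair of TYPE A and analytic rank `0` (the twist swaps the types,
`gvPar_twist_iff_not_gvPar_of_neg`), whose `BSD(E^K,p)` is ladder row A3, i.e. EXACTLY what the crux
`MazurMCOnX1RankZero` of route `EisensteinPrimes` (rung K5, item stmt-BirchSwinnertonDyer-19035)
supplies (`Rank1ResidualX1Defs.bsdp_of_classX1_of_analyticRank_eq_zero`, Greenberg Thm. 4.1). Hence,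
with NO `p`-adic height, NO Schneider certificate and NO critical-slope object:

  `h308` (PRE) + `h511` (CGLS Thm. 5.1.1, PUB) + crux `MazurMCOnX1RankZero` (item 19035) + PUB
    ⟹ the leaf `SchneiderWeaken.TypeBRankOneUnridered` ⟹ the crux `Theses.SlopeDichotomyA2.DegenerateLocusA2`.

Ledger reading (frontier): item 19086 sits BELOW {`h308`, item 19035} ∪ PUB — a refutation of 19086
would refute Keller–Yin Thm. 3.0.8 (good lattice, at `𝟙`) or Mazur's main conjecture at a type-A
anomalous rank-zero pair (or a published theorem). Conversely the `bsd-eis` cell proved crux 5 ⟸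
crux 6 `SchneiderOnX1TypeB` + the mirror display (`EisensteinPrimesMazurMCOnX1RankZero` §6): on class
X1 the Schneider rider of A2 and the rank-zero type-A input of A3 are interchangeable modulo
Keller–Yin-type anticyclotomic displays.

## Contents

* `pPartRankZero_twist_of_gvPar_of_bsdp_rankZero` — the partner of a TYPE-B X1 pair is a TYPE-A
  rank-zero class-X1 pair; its print shape from the rank-zero supply.
* `bsdp_goodLattice_of_gvPar_of_analyticRank_eq_one` — `BSD(E',p)` for the good lattice of a
  rank-one type-B X1 pair (twin of eis `bsdp_goodLattice_of_not_gvPar_of_analyticRank_eq_one`).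
* `bsdp_of_isIsogenous_goodLattice_of_gvPar_of_analyticRank_eq_one`,
  `bsdp_of_classX1_of_gvPar_of_analyticRank_eq_one` — every member of the class (Cassels), the good
  lattice existing by the tree THEOREM `GoodLatticeExists.ribet_exists_isIsogenous_noUnramifiedLine_holds`.
* `bsdp_rankZero_supply_of_mazurMCOnX1RankZero` — K5's crux 5 ⟹ the rank-zero supply.
* `typeBRankOneUnridered_of_h308_of_mazurMCOnX1RankZero` — the rung-I1 LEAF, Schneider-free.
* `degenerateLocusA2_of_h308_of_mazurMCOnX1RankZero`, `degenerateLocusA2_of_h308_of_bsdp_rankZero` —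
  the route decl of item 19086 BY NAME (conditional results).

Riders: none on `p` beyond `ClassX1` (`p > 2`); `h308`'s weight-2 Kolyvagin system is [CGLS]
Thm. 4.1.1 / Howard 2004 (see `X1/KellerYinTheoremA.lean`, "Riders recorded"); KY's Appendix B is
NOT used (the good lattice has no `p`-torsion over `K`, so [CGLS] Thm. 5.1.1 as proved suffices).

References: [KellerYin2024] arXiv:2402.12781v2 §0.1, §0.5, §2 (first paragraph), Thm. 3.0.8,
Prop. 1.3.1, Thm. 4.2.1 and its proof; [CastellaGrossiLeeSkinner2022] Thm. 5.3.1 and proof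
(5.4)–(5.7), Thms. 5.1.1, 5.1.3; [GreenbergLNM1716] Thm. 4.1; [Ribet1976] Prop. 2.1; [MilneADT2006]
I.7.3; [HoffsteinLuo1997]; [GrossZagier1986] I.7.3, V.§2; [Miller2011LMS] Def. 1.1; cell files
`run/shared/lean/pub/bsd-eis/bsd-eis-ky-MEMO-1.md` §2–§3, `run/shared/lean/pub/bsd-schneider-ideate/memos/i1-c2/`.
-/

set_option autoImplicit false
set_option linter.dupNamespace false

noncomputable section

open scoped Classical

namespace Summit.BirchSwinnertonDyer.BirchSwinnertonDyer.Theorems.DegenerateLocusA2AnticyclotomicRoad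

open WeierstrassCurve NumberField Literature.NumberTheory.EllipticCurves
  Literature.NumberTheory.EllipticCurves.ModularForms Literature.NumberTheory.QuadraticFields
  Literature.NumberTheory.EllipticCurves.Rank1Residual
  Literature.NumberTheory.EllipticCurves.CastellaGrossiLeeSkinner2022
  Literature.NumberTheory.GaloisRepresentations
  Literature.NumberTheory.EllipticCurves.KellerYin2024
  Summit.BirchSwinnertonDyer.Rank1Residual
  Summit.BirchSwinnertonDyer.Rank1Residual.X1.KellerYinGoodLattice
  Summit.BirchSwinnertonDyer.Rank1Residual.X1.KellerYinTheoremA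
  Summit.BirchSwinnertonDyer.BirchSwinnertonDyer.Theorems
  Summit.BirchSwinnertonDyer.BirchSwinnertonDyer.Theses

variable {p : ℕ} [Fact p.Prime]

/-- **The partner of a TYPE-B X1 pair: its admissible odd twist of analytic rank zero is a class-X1
pair of TYPE A, so its rank-zero print shape comes from `BSD(E',p)` at the rank-zero class-X1 pairs.**
For `W/ℚ` globally minimal elliptic with `ClassX1 W p` (`p > 2` good, `E[p]` reducible, anomalous)
and `GVPar W p` (type B), `K` imaginary quadratic with `d_K` odd and `p` split, `L(E^{(d_K)},1) ≠ 0`,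
and `Wd` a globally minimal model of `E^{(d_K)}`: `Wd` is good ordinary at `p`
(`isOrdinaryAt_of_smul_eq_quadraticTwist`, `p ∤ 2d_K`), `E^{(d_K)}[p]` is reducible
(`not_hasIrreducibleModPGaloisRep_twist`), anomalous (`a_p(E^K) = a_p(E)`,
`frobeniusTrace_eq_of_split_twist`), of parity TYPE A (`gvPar_twist_iff_not_gvPar_of_neg`: the odd
twist unramified at `p` swaps the types) and of analytic rank `0`; hence `ClassX1 Wd p` (the class
clause `¬(r = 0 ∧ gvpar)` holds BECAUSE the twist is of type A), `BSDp Wd p` by the rank-zero supply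
`h0`, and the print shape by `pPart_of_bsdp` / `pPartRankZero_of_pPart` (modularity `hmod`, GZK
`hGZK`). Compare the type-A case `pPartRankZero_twist_of_not_gvPar` (partner of type B:
Greenberg–Vatsal, PUBLISHED). [cite: CastellaGrossiLeeSkinner2022, proof of Thm. 5.3.1 (last paragraph: the twist law)]
[cite: Miller2011LMS, Def. 1.1] -/
theorem pPartRankZero_twist_of_gvPar_of_bsdp_rankZero
    (h0 : ∀ (W' : WeierstrassCurve ℚ) [W'.IsElliptic] [W'.IsGloballyMinimal],
      ClassX1 W' p → W'.analyticRank = 0 → BSDp W' p)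
    (hmod : hasEntireLFunction_rat) (hGZK : rank_eq_analyticRank_of_analyticRank_le_one)
    (W : WeierstrassCurve ℚ) [W.IsElliptic] [W.IsGloballyMinimal]
    (hX1 : ClassX1 W p) (hB : GVPar W p)
    (K : Type) [Field K] [NumberField K] (hK : IsImaginaryQuadratic K)
    (hodd : Odd (NumberField.discr K)) (hsplit : SatisfiesHeegnerHypothesis p K)
    (hLK : (W.quadraticTwist (NumberField.discr K : ℚ)).entireLFunction 1 ≠ 0)
    (Wd : WeierstrassCurve ℚ) [Wd.IsElliptic] [Wd.IsGloballyMinimal]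
    (hWd : ∃ C : VariableChange ℚ, C • Wd = W.quadraticTwist (NumberField.discr K : ℚ)) :
    PPartRankZero Wd p := by
  have hp : p.Prime := Fact.out
  have hp2 : p ≠ 2 := by have := hX1.1; omega
  have hgood : W.HasGoodReductionAtPrime p := hX1.2.2.1
  have hred : ¬ W.HasIrreducibleModPGaloisRep p := hX1.2.1
  have hanom : (p : ℤ) ∣ W.frobeniusTrace p - 1 := hX1.2.2.2.1.2.2
  have hord : ¬ (p : ℤ) ∣ W.frobeniusTrace p :=
    KellerYin2024.not_dvd_frobeniusTrace_of_anomalous W p hanom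
  obtain ⟨C, hC⟩ := hWd
  have hdneg : NumberField.discr K < 0 := IsImaginaryQuadratic.discr_neg hK
  have hsqf : Squarefree (NumberField.discr K) := squarefree_discr_of_odd hK hodd
  have hpd : ¬ (p : ℤ) ∣ NumberField.discr K := not_dvd_discr_of_split hK hp hp2 hsplit
  have hd0 : (NumberField.discr K : ℚ) ≠ 0 := by exact_mod_cast hdneg.ne
  -- `Wd` is good ordinary at `p`, reducible, of type A, anomalous, of analytic rank `0`
  obtain ⟨hgood_d, -⟩ :=
    isOrdinaryAt_of_smul_eq_quadraticTwist W Wd hsqf hC p hp2 hpd ⟨hgood, hord⟩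
  have hred_d : ¬ Wd.HasIrreducibleModPGaloisRep p :=
    not_hasIrreducibleModPGaloisRep_twist hred hd0 Wd C hC
  have hA_d : ¬ GVPar Wd p := fun hd ↦
    (gvPar_twist_iff_not_gvPar_of_neg hp2 hgood hord hred hdneg hpd C hC).mp hd hB
  have ha : Wd.frobeniusTrace p = W.frobeniusTrace p :=
    CastellaGrossiLeeSkinner2022.frobeniusTrace_eq_of_split_twist hX1.1 hgood K hK hodd hsplit Wd
      ⟨C, hC⟩
  have hanom_d : (p : ℤ) ∣ Wd.frobeniusTrace p - 1 := by rw [ha]; exact hanom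
  have hLd : Wd.entireLFunction 1 ≠ 0 := by
    rw [← Wd.entireLFunction_smul C, hC]
    exact hLK
  have hrd : Wd.analyticRank = 0 := analyticRank_eq_zero_of_entireLFunction_one_ne_zero hLd
  have hX1d : ClassX1 Wd p :=
    ⟨hX1.1, hred_d, hgood_d, ⟨hred_d, hgood_d, hanom_d⟩, fun h ↦ hA_d h.2⟩
  -- the rank-zero supply and the print shape
  have hBd : BSDp Wd p := h0 Wd hX1d hrd
  exact pPartRankZero_of_pPart hGZK Wd p hrd (pPart_of_bsdp hmod hGZK Wd p (by omega) hBd)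

/-- **`BSD(E',p)` for the GOOD LATTICE of a rank-one TYPE-B X1 pair — the type-B twin of eis's
THEOREM A (`bsdp_goodLattice_of_not_gvPar_of_analyticRank_eq_one`) by the SAME anticyclotomic road.**
For `W/ℚ` globally minimal elliptic with `ClassX1 W p` (`p > 2` good, `E[p]` reducible, anomalous),
parity type B (`GVPar W p`), `ord_{s=1} L(E,s) = 1`, and Keller–Yin's lattice normalisation "no
rational `p`-line of `E` is unramified at `p`" (`hGL`): Miller's `BSD(E,p)`, with NO Schneider
certificate and NO `p`-adic height. Inputs: the ONE preprint statement `h308` (Keller–Yin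
arXiv:2402.12781v2 Thm. 3.0.8 (IMC2) at `𝟙` ∘ BDP for the good lattice — stated WITHOUT any parity
hypothesis); the PUBLISHED named facts [CGLS] Thm. 5.1.1 as proved (`h511`), modularity (`hmodP`,
`hmod`), Hoffstein–Luo (`hHL`, the admissible `K`), Gross–Zagier (`hGZQ` over `ℚ`, `hGZ` over `K`),
Kolyvagin (`hKo`), GZK (`hGZK`); and the rank-zero supply `h0` — `BSD(E',p)` at every class-X1 pair
`(E', p)` of analytic rank `0` (ladder row A3; the crux `MazurMCOnX1RankZero` of route
`EisensteinPrimes` gives it, `bsdp_rankZero_supply_of_mazurMCOnX1RankZero`). Assembly: the Keller–Yin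
display for the good lattice at `(E', p, K, Wd)` (`KellerYinTheoremA.display_at_goodLattice`, which
uses no parity) + the partner's rank-zero print shape (`pPartRankZero_twist_of_gvPar_of_bsdp_rankZero`:
the partner is of TYPE A) ⟹ `BSDp W p` (`bsdp_of_display_at_of_pPartRankZero`, x1a).
[claim: KellerYin2024, status: under-review]
[cite: KellerYin2024, Thm. 4.2.1 (Theorem C) and its proof (arXiv:2402.12781v2 §4.2), Thm. 3.0.8]
[cite: CastellaGrossiLeeSkinner2022, Thm. 5.3.1 and its proof ((a)–(d), (5.4)–(5.7)), Thms. 5.1.1, 5.1.3]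
[cite: HoffsteinLuo1997, Theorem (§1)] [cite: GrossZagier1986, Thm. I.7.3, V.§2]
[cite: Miller2011LMS, Def. 1.1] -/
theorem bsdp_goodLattice_of_gvPar_of_analyticRank_eq_one
    (h308 : thm308_imc2_bdpValue_goodLattice_OPEN) (h511 : thm511_anticyclotomicControl_of_torsionFree)
    (h0 : ∀ (W' : WeierstrassCurve ℚ) [W'.IsElliptic] [W'.IsGloballyMinimal],
      ClassX1 W' p → W'.analyticRank = 0 → BSDp W' p)
    (hmodP : nonempty_modularParametrizationData) (hmod : exists_isNewformOf)
    (hHL : HoffsteinLuo1997_exists_twist_L_one_ne_zero) (hGZQ : GrossZagier1986_thm_I_7_3)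
    (hGZ : ∀ (N : ℕ) [NeZero N] (W : WeierstrassCurve ℚ) (K : Type) [Field K] [NumberField K],
      gross_zagier N W K)
    (hKo : ∀ (N : ℕ) [NeZero N] (W : WeierstrassCurve ℚ) (K : Type) [Field K] [NumberField K],
      kolyvagin N W K)
    (hGZK : rank_eq_analyticRank_of_analyticRank_le_one)
    (W : WeierstrassCurve ℚ) [W.IsElliptic] [W.IsGloballyMinimal]
    (hX1 : ClassX1 W p) (hB : GVPar W p)
    (hGL : ∀ Φ : AddSubgroup (geomTorsion W (p : ℤ)), IsRationalLine W p Φ → ¬ LineUnramifiedAt W p Φ)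
    (hr : W.analyticRank = 1) : BSDp W p := by
  obtain ⟨hp, hred, hgood, han, -⟩ := hX1
  have hmod' : hasEntireLFunction_rat := hasEntireLFunction_rat_of_exists_isNewformOf hmod
  -- `w(E) = -1` from `ord_{s=1} L(E,s) = 1`
  have hw : W.rootNumber = -1 := by
    have h := even_analyticRank_iff_rootNumber_eq_one.rootNumber_eq_neg_one_pow (W := W)
      (even_analyticRank_iff_rootNumber_eq_one_of_exists_isNewformOf W hmod)
    rw [hr, pow_one] at h
    exact h
  -- the admissible auxiliary field `K` ((a)–(d)) and a globally minimal model `Wd` of `E^{(D_K)}`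
  obtain ⟨K, _, _, hK, hodd, hlt, hHN, hHp, hLK⟩ :=
    exists_admissibleField_of_rootNumber_eq_neg_one hmod hHL W hw p
  have hd0 : (NumberField.discr K : ℚ) ≠ 0 := by
    exact_mod_cast (show NumberField.discr K ≠ 0 by omega)
  obtain ⟨Wd, _, _, C, hC⟩ := exists_isGloballyMinimal_smul_eq_quadraticTwist W hd0
  -- the partner's rank-`0` print shape: the type-A twist, by the rank-zero supply
  have hP : PPartRankZero Wd p :=
    pPartRankZero_twist_of_gvPar_of_bsdp_rankZero h0 hmod' hGZK W ⟨hp, hred, hgood, han, fun h ↦ by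
      omega⟩ hB K hK hodd hHp hLK Wd ⟨C, hC⟩
  -- the display at `(E', p, K, Wd)`, then `BSD(E',p)`
  exact bsdp_of_display_at_of_pPartRankZero hmod hGZQ hGZK W p hr Wd hP
    (display_at_goodLattice h308 h511 hmodP hGZ hKo hGZK hmod' W hp hgood hred han hGL hr K hK hodd hlt
      hHN hHp hLK Wd ⟨C, hC⟩)

/-- **`BSD(E,p)` for EVERY member of a rank-one type-B X1 isogeny class containing a KY-normalised
member** (Cassels' isogeny invariance of the BSD quotient, `hCassels`; the hypotheses on the census
curve `V` transport to `W`: `ClassX1.of_isIsogenous`, `gvPar_iff_of_isIsogenous_of_anom`,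
`analyticRank_eq_of_isIsogenous'`; `Wuthrich2014.bsdp_of_isIsogenous` carries `BSD(W,p)` back). The
type-B twin of eis's `bsdp_of_isIsogenous_goodLattice_of_not_gvPar_of_analyticRank_eq_one`.
[claim: KellerYin2024, status: under-review]
[cite: KellerYin2024, Thm. 4.2.1 (Theorem C) and its proof (arXiv:2402.12781v2 §4.2), Prop. 1.3.1]
[cite: MilneADT2006, Thm. I.7.3 and Remark I.7.4] -/
theorem bsdp_of_isIsogenous_goodLattice_of_gvPar_of_analyticRank_eq_one
    (h308 : thm308_imc2_bdpValue_goodLattice_OPEN) (h511 : thm511_anticyclotomicControl_of_torsionFree)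
    (h0 : ∀ (W' : WeierstrassCurve ℚ) [W'.IsElliptic] [W'.IsGloballyMinimal],
      ClassX1 W' p → W'.analyticRank = 0 → BSDp W' p)
    (hCassels : bsdRHS_eq_of_isIsogenous)
    (hmodP : nonempty_modularParametrizationData) (hmod : exists_isNewformOf)
    (hHL : HoffsteinLuo1997_exists_twist_L_one_ne_zero) (hGZQ : GrossZagier1986_thm_I_7_3)
    (hGZ : ∀ (N : ℕ) [NeZero N] (W : WeierstrassCurve ℚ) (K : Type) [Field K] [NumberField K],
      gross_zagier N W K)
    (hKo : ∀ (N : ℕ) [NeZero N] (W : WeierstrassCurve ℚ) (K : Type) [Field K] [NumberField K],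
      kolyvagin N W K)
    (hGZK : rank_eq_analyticRank_of_analyticRank_le_one)
    (V : WeierstrassCurve ℚ) [V.IsElliptic] [V.IsGloballyMinimal]
    (hX1 : ClassX1 V p) (hB : GVPar V p) (hr : V.analyticRank = 1)
    (W : WeierstrassCurve ℚ) [W.IsElliptic] [W.IsGloballyMinimal] (hiso : IsIsogenous V W)
    (hGL : ∀ Φ : AddSubgroup (geomTorsion W (p : ℤ)), IsRationalLine W p Φ → ¬ LineUnramifiedAt W p Φ) :
    BSDp V p := by
  have hp2 : p ≠ 2 := by have := hX1.1; omega
  have hX1' : ClassX1 W p := ClassX1.of_isIsogenous hiso hX1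
  have hB' : GVPar W p := (gvPar_iff_of_isIsogenous_of_anom hp2 hX1.2.2.2.1 hX1'.2.2.2.1 hiso).mp hB
  have hr' : W.analyticRank = 1 := (analyticRank_eq_of_isIsogenous' hiso).symm.trans hr
  have hBSD' : BSDp W p := bsdp_goodLattice_of_gvPar_of_analyticRank_eq_one h308 h511 h0 hmodP hmod
    hHL hGZQ hGZ hKo hGZK W hX1' hB' hGL hr'
  obtain ⟨-, hfin'⟩ := hGZK W (by omega)
  have hlead' : W.leadingLCoeff ≠ 0 :=
    WeierstrassCurve.leadingLCoeff_ne_zero_holds (hasEntireLFunction_rat_of_exists_isNewformOf hmod W)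
  exact Wuthrich2014.bsdp_of_isIsogenous hCassels hiso hfin' hlead' hBSD'

/-- **X1 ∩ {type B, `r_an = 1`} ⟹ `BSD(E,p)` — corner A2 by the Schneider-free anticyclotomic road,
at the h308 level.** For `W/ℚ` globally minimal elliptic, `ClassX1 W p`, `GVPar W p`,
`ord_{s=1} L(E,s) = 1`: Miller's `BSD(E,p)` from the ONE preprint statement `h308` (Keller–Yin
Thm. 3.0.8 (IMC2) at `𝟙` for the good lattice), the rank-zero supply `h0` (`BSD(E',p)` at the
rank-zero class-X1 pairs — row A3, K5's crux `MazurMCOnX1RankZero`), and the PUBLISHED named facts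
`h511`, `hCassels`, `hmodP`, `hmod`, `hHL`, `hGZQ`, `hGZ`, `hKo`, `hGZK`. The KY-normalised member of
the class exists by the tree THEOREM `GoodLatticeExists.ribet_exists_isIsogenous_noUnramifiedLine_holds`
(Ribet's lemma). No Greenberg–Vatsal, no Schneider 1985, no Perrin-Riou 1987, no Mazur–Tate `σ`: the
cyclotomic road is not used. [claim: KellerYin2024, status: under-review]
[cite: KellerYin2024, Thm. 4.2.1 (Theorem C) and its proof (arXiv:2402.12781v2 §4.2), Thm. 3.0.8, Prop. 1.3.1]
[cite: Ribet1976, Prop. 2.1] [cite: CastellaGrossiLeeSkinner2022, Thm. 5.3.1 and its proof, Thm. 5.1.1] -/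
theorem bsdp_of_classX1_of_gvPar_of_analyticRank_eq_one
    (h308 : thm308_imc2_bdpValue_goodLattice_OPEN) (h511 : thm511_anticyclotomicControl_of_torsionFree)
    (h0 : ∀ (W' : WeierstrassCurve ℚ) [W'.IsElliptic] [W'.IsGloballyMinimal],
      ClassX1 W' p → W'.analyticRank = 0 → BSDp W' p)
    (hCassels : bsdRHS_eq_of_isIsogenous)
    (hmodP : nonempty_modularParametrizationData) (hmod : exists_isNewformOf)
    (hHL : HoffsteinLuo1997_exists_twist_L_one_ne_zero) (hGZQ : GrossZagier1986_thm_I_7_3)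
    (hGZ : ∀ (N : ℕ) [NeZero N] (W : WeierstrassCurve ℚ) (K : Type) [Field K] [NumberField K],
      gross_zagier N W K)
    (hKo : ∀ (N : ℕ) [NeZero N] (W : WeierstrassCurve ℚ) (K : Type) [Field K] [NumberField K],
      kolyvagin N W K)
    (hGZK : rank_eq_analyticRank_of_analyticRank_le_one)
    (W : WeierstrassCurve ℚ) [W.IsElliptic] [W.IsGloballyMinimal]
    (hX1 : ClassX1 W p) (hB : GVPar W p) (hr : W.analyticRank = 1) : BSDp W p := by
  obtain ⟨W', _, _, hiso, hGL⟩ :=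
    X1.GoodLatticeExists.ribet_exists_isIsogenous_noUnramifiedLine_holds W p hX1.1 hX1.2.2.1 hX1.2.1
  exact bsdp_of_isIsogenous_goodLattice_of_gvPar_of_analyticRank_eq_one h308 h511 h0 hCassels hmodP
    hmod hHL hGZQ hGZ hKo hGZK W hX1 hB hr W' hiso hGL

/-- **The rank-zero supply from K5's crux 5.** The hypothesis `h5` is VERBATIM the body of the crux
`MazurMCOnX1RankZero` of route `EisensteinPrimes` (item stmt-BirchSwinnertonDyer-19035: Mazur's main
conjecture at every class-X1 pair of analytic rank `0`; the by-name corollary lives in the companion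
placement file, which imports that route); with Greenberg 1999 Thm. 4.1 (`hGr`), modularity (`hmodP`)
and GZK (`hGZK`) it gives `BSD(E',p)` at every class-X1 pair of analytic rank `0` (x1b's
`Rank1ResidualX1Defs.bsdp_of_classX1_of_analyticRank_eq_zero`). [cite: GreenbergLNM1716, Thm. 4.1]
[cite: Miller2011LMS, Def. 1.1] -/
theorem bsdp_rankZero_supply_of_mazurMCOnX1RankZero
    (h5 : ∀ (W : WeierstrassCurve ℚ) [W.IsElliptic] [W.IsGloballyMinimal] (p : ℕ) [Fact p.Prime],
      ClassX1 W p → W.analyticRank = 0 → Rank1ResidualX1Defs.MazurMainConjecture W p)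
    (hGr : greenberg_charValue_rankZero) (hmodP : nonempty_modularParametrizationData)
    (hGZK : rank_eq_analyticRank_of_analyticRank_le_one)
    (W' : WeierstrassCurve ℚ) [W'.IsElliptic] [W'.IsGloballyMinimal] (p : ℕ) [Fact p.Prime]
    (hX1' : ClassX1 W' p) (hr0 : W'.analyticRank = 0) : BSDp W' p :=
  Rank1ResidualX1Defs.bsdp_of_classX1_of_analyticRank_eq_zero hGr hmodP hGZK W' p hX1' hr0
    (h5 W' p hX1' hr0)

/-- **The rung-I1 LEAF `TypeBRankOneUnridered` at the h308 level, Schneider-free.** Granted the ONE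
preprint statement `h308` (KY Thm. 3.0.8 at `𝟙` for the good lattice; = the `_OPEN` input of K5's
crux 2, type-agnostic as typed), K5's crux 5 `MazurMCOnX1RankZero` (`h5` = its body verbatim; item
19035), and the PUBLISHED named facts [CGLS] Thm. 5.1.1 (`h511`), Cassels (`hCassels`), Greenberg Thm. 4.1
(`hGr`), modularity (`hmodP`, `hmod`), Hoffstein–Luo (`hHL`), Gross–Zagier (`hGZQ`, `hGZ`), Kolyvagin
(`hKo`), GZK (`hGZK`): `BSD(E,p)` at EVERY corner-A2 pair. [claim: KellerYin2024, status: under-review]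
[cite: KellerYin2024, Thm. 4.2.1 (Theorem C) and its proof (arXiv:2402.12781v2 §4.2), Thm. 3.0.8]
[cite: CastellaGrossiLeeSkinner2022, Thm. 5.3.1 and its proof, Thm. 5.1.1] -/
theorem typeBRankOneUnridered_of_h308_of_mazurMCOnX1RankZero
    (h308 : thm308_imc2_bdpValue_goodLattice_OPEN) (h511 : thm511_anticyclotomicControl_of_torsionFree)
    (h5 : ∀ (W : WeierstrassCurve ℚ) [W.IsElliptic] [W.IsGloballyMinimal] (p : ℕ) [Fact p.Prime],
      ClassX1 W p → W.analyticRank = 0 → Rank1ResidualX1Defs.MazurMainConjecture W p)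
    (hCassels : bsdRHS_eq_of_isIsogenous) (hGr : greenberg_charValue_rankZero)
    (hmodP : nonempty_modularParametrizationData) (hmod : exists_isNewformOf)
    (hHL : HoffsteinLuo1997_exists_twist_L_one_ne_zero) (hGZQ : GrossZagier1986_thm_I_7_3)
    (hGZ : ∀ (N : ℕ) [NeZero N] (W : WeierstrassCurve ℚ) (K : Type) [Field K] [NumberField K],
      gross_zagier N W K)
    (hKo : ∀ (N : ℕ) [NeZero N] (W : WeierstrassCurve ℚ) (K : Type) [Field K] [NumberField K],
      kolyvagin N W K)
    (hGZK : rank_eq_analyticRank_of_analyticRank_le_one) :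
    SchneiderWeaken.TypeBRankOneUnridered :=
  fun W _ _ p _ hTB ↦
    bsdp_of_classX1_of_gvPar_of_analyticRank_eq_one h308 h511
      (fun W' _ _ hX1' hr0 ↦ bsdp_rankZero_supply_of_mazurMCOnX1RankZero h5 hGr hmodP hGZK W' p hX1' hr0)
      hCassels hmodP hmod hHL hGZQ hGZ hKo hGZK W hTB.1 hTB.2.2 hTB.2.1

/-- **Crux `DegenerateLocusA2` (item stmt-BirchSwinnertonDyer-19086) at the h308 level,
Schneider-free** — the route decl of `SlopeDichotomyA2` BY NAME from `h308` (PRE), K5's crux 5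
(`h5` = the body of `EisensteinPrimes.MazurMCOnX1RankZero` verbatim; item 19035) and the published
facts (as in `typeBRankOneUnridered_of_h308_of_mazurMCOnX1RankZero`). CONDITIONAL RESULT; nothing closed. Ledger
reading: 19086 ≤ {h308, 19035} ∪ PUB. [claim: KellerYin2024, status: under-review]
[cite: KellerYin2024, Thm. 4.2.1 (Theorem C) and its proof (arXiv:2402.12781v2 §4.2), Thm. 3.0.8]
[cite: Miller2011LMS, Def. 1.1] -/
theorem degenerateLocusA2_of_h308_of_mazurMCOnX1RankZero
    (h308 : thm308_imc2_bdpValue_goodLattice_OPEN) (h511 : thm511_anticyclotomicControl_of_torsionFree)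
    (h5 : ∀ (W : WeierstrassCurve ℚ) [W.IsElliptic] [W.IsGloballyMinimal] (p : ℕ) [Fact p.Prime],
      ClassX1 W p → W.analyticRank = 0 → Rank1ResidualX1Defs.MazurMainConjecture W p)
    (hCassels : bsdRHS_eq_of_isIsogenous) (hGr : greenberg_charValue_rankZero)
    (hmodP : nonempty_modularParametrizationData) (hmod : exists_isNewformOf)
    (hHL : HoffsteinLuo1997_exists_twist_L_one_ne_zero) (hGZQ : GrossZagier1986_thm_I_7_3)
    (hGZ : ∀ (N : ℕ) [NeZero N] (W : WeierstrassCurve ℚ) (K : Type) [Field K] [NumberField K],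
      gross_zagier N W K)
    (hKo : ∀ (N : ℕ) [NeZero N] (W : WeierstrassCurve ℚ) (K : Type) [Field K] [NumberField K],
      kolyvagin N W K)
    (hGZK : rank_eq_analyticRank_of_analyticRank_le_one) :
    Summit.BirchSwinnertonDyer.BirchSwinnertonDyer.Theses.SlopeDichotomyA2.DegenerateLocusA2 :=
  fun W _ _ p _ hTB _ ↦
    typeBRankOneUnridered_of_h308_of_mazurMCOnX1RankZero h308 h511 h5 hCassels hGr hmodP hmod hHL hGZQ
      hGZ hKo hGZK W p hTB

/-- **The crux with the rank-zero input in its weakest consumed form, at the h308 level**: `h308`,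
`h511`, `BSD(E',p)` at the rank-zero class-X1 pairs (`h0`, all primes), Cassels, modularity,
Hoffstein–Luo, Gross–Zagier, Kolyvagin, GZK ⟹ `DegenerateLocusA2`.
[claim: KellerYin2024, status: under-review]
[cite: KellerYin2024, Thm. 4.2.1 (Theorem C) and its proof (arXiv:2402.12781v2 §4.2), Thm. 3.0.8] -/
theorem degenerateLocusA2_of_h308_of_bsdp_rankZero
    (h308 : thm308_imc2_bdpValue_goodLattice_OPEN) (h511 : thm511_anticyclotomicControl_of_torsionFree)
    (h0 : ∀ (W' : WeierstrassCurve ℚ) [W'.IsElliptic] [W'.IsGloballyMinimal] (p : ℕ) [Fact p.Prime],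
      ClassX1 W' p → W'.analyticRank = 0 → BSDp W' p)
    (hCassels : bsdRHS_eq_of_isIsogenous)
    (hmodP : nonempty_modularParametrizationData) (hmod : exists_isNewformOf)
    (hHL : HoffsteinLuo1997_exists_twist_L_one_ne_zero) (hGZQ : GrossZagier1986_thm_I_7_3)
    (hGZ : ∀ (N : ℕ) [NeZero N] (W : WeierstrassCurve ℚ) (K : Type) [Field K] [NumberField K],
      gross_zagier N W K)
    (hKo : ∀ (N : ℕ) [NeZero N] (W : WeierstrassCurve ℚ) (K : Type) [Field K] [NumberField K],
      kolyvagin N W K)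
    (hGZK : rank_eq_analyticRank_of_analyticRank_le_one) :
    Summit.BirchSwinnertonDyer.BirchSwinnertonDyer.Theses.SlopeDichotomyA2.DegenerateLocusA2 :=
  fun W _ _ p _ hTB _ ↦
    bsdp_of_classX1_of_gvPar_of_analyticRank_eq_one h308 h511 (fun W' _ _ hX1' hr0 ↦ h0 W' p hX1' hr0)
      hCassels hmodP hmod hHL hGZQ hGZ hKo hGZK W hTB.1 hTB.2.2 hTB.2.1

end Summit.BirchSwinnertonDyer.BirchSwinnertonDyer.Theorems.DegenerateLocusA2AnticyclotomicRoad

end
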